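import Summits.ValiantsHypothesis.ValiantsHypothesis.Theorems.KPlusLogSqLawTropicalBSplitDefs
import Summits.ValiantsHypothesis.ValiantsHypothesis.Theorems.KPlusLogSqLawTropicalExchange

/-!
# Route «KPlusLogSqLaw», crux `TropicalB` (stmt-ValiantsHypothesis-19771) — PATH-COUPLED FAMILIES ARE QUADRATIC
# (abstract exchange quadruples; co-monotone fibres; the «double register» bound)

HONEST FRAMING.  Helper file of the object-search cell `pub-symmetroid` (seat val-sym-trop-p5 g4, refuter-adjacent lane) for the crux
`Summit.ValiantsHypothesis.ValiantsHypothesis.Theses.KPlusLogSqLaw.TropicalB` (ledger item `stmt-ValiantsHypothesis-19771`; registered stubs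
`stub_tropThin` / `stub_tropFat` of `Cruxes/TropicalB/Lines/birth.lean`, each ⟺ the crux), landed `--supports`.  It does NOT close the item
and asserts nothing about `TropicalB` in its window, `WeakLifting`, `KPlusLogSqLaw`, `MatrixDescartes` (stmt-ValiantsHypothesis-18050) or
`VP ≠ VNP`.  Everything below is a STRUCTURAL fact about unique optima (`IsDominant`) of an ARBITRARY dominance design `(d, v, ε)`:
no support class, no exponent regime, no sign condition.

THE STATEMENTS.
* `PathCoupling.slope_lt_of_exchange` — the EXCHANGE INEQUALITY in its abstract form: if `p` is dominant at `θa`, `p'` at `θb > θa`, and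
  `q, q'` are PRESENT terms with `slope q + slope q' = slope p + slope p'` and the same identity for the valuation sums
  `Σ_i v (σ i) i (λ i)`, then `q ≠ p ⇒ slope p < slope q` and `q' ≠ p' ⇒ slope q' < slope p'` (the dominant pair is the OUTER pair).
  Only the two sums enter — no column structure.  (The tree's `TropicalCensus.slope_lt_of_resplit` / `sum_lt_sum_of_swap`
  (…TropicalExchange, val-sym-lift-p1) are the column-wise re-split instances, `ConvexPosition.sidon` (…TropicalBConvexPosition, val-sym-trop-p2)
  the instance with four dominant terms; the mechanism — add two dominance inequalities, the valuations cancel — is the same and is folklore.)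
* `PathCoupling.lt_of_fibre` — CO-MONOTONE FIBRES.  Let `u a b c` (`a : ι₁, b : ι₂, c : ι₃`) be an injective family of present terms whose
  slope is additively separable, `slope (u a b c) = α a + β b + γ c`, and whose valuation sum is PATH-COUPLED,
  `Σ_i v … (u a b c) = f a b + g b c` (the middle index may interact with both outer ones, the outer ones not with each other).  If `u a b c`
  is dominant at `θa` and `u a' b c'` (SAME `b`) at `θb > θa`, then `c ≠ c' ⇒ γ c < γ c'` and `a ≠ a' ⇒ α a < α a'`: inside a `b`-fibre the two
  outer coordinates move UP TOGETHER.  (Exchange pair: `u a b c'`, `u a' b c`.)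
* `PathCoupling.card_fibre_le`, `PathCoupling.card_family_le` — the count: along any chain of dominant terms at strictly increasing slopes with
  consecutive terms distinct (hence pairwise distinct, `injective_of_chainD`), at most `|ι₁| + |ι₃| − 1` indices carry a term `u a b c` with a FIXED `b`, hence at most `|ι₂|·(|ι₁| + |ι₃| − 1)`
  indices carry a term of the family at all — QUADRATIC in the side lengths, against the `|ι₁|·|ι₂|·|ι₃|` members of the family.

READING (located; refuter calibration, no claim on `TropicalB`).  (1) `ι₂` a point: a product family `u a c` with separable slope AND separable
valuation («two autonomous registers», direct sums, torus rows) meets every dominant chain in ≤ `|ι₁| + |ι₃| − 1` terms — the Minkowski count,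
support-free (compare `Halves.halves_subadditive`, which is the column-cut form with row-image classes).  (2) The DOUBLE REGISTER (two jump
cycles on one track with three free boundaries `p₁ < p₂ < p₃`, jump valuations `J₁(p₁,p₂) + J₂(p₂,p₃)`, walk valuations unary, all boundary
triples present) is a path-coupled family with `b = p₂`: ≤ `r(2r − 1)` dominant states out of `r³` — two jumps on a track do not make three
digits multiply (cell fork D2, «K = 4 cubic?», smooth side).  (3) Generally, for a product family whose valuation decomposes along a factor graph
`H` on the coordinates, every vertex separator `Z` of `H` gives «(Π over Z) × (Σ over the components)»; for `H` of maximum degree 2 half of the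
coordinates multiply.  A 4-CYCLE `H` is NOT covered: `V(x) = (w·x)² + ν(x₁+x₄−x₂−x₃)²` with `w₁w₃ = w₂w₄ = ν` is a sum of four edge functions whose
equality set with `(w·x)²` has ≈ `2r³/3` points with distinct `w·x` (seat memo ARCHITECTURE.md §3) — so the quadratic ceiling is a property of
PATHS, not of pairwise coupling.  [folklore: vertices of Minkowski sums / exchange arguments for assignment LPs; the packaging is the cell's]
-/

set_option linter.dupNamespace false
set_option autoImplicit false

namespace Summit.ValiantsHypothesis.ValiantsHypothesis.Theorems.KPlusLogSqLaw

open Summit.ValiantsHypothesis.ValiantsHypothesis.Theorems.MatrixDescartes.Negative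
open Summit.ValiantsHypothesis.ValiantsHypothesis.Theorems.LacunarySymmetroidMatrixDescartes.TropicalCensus
open scoped BigOperators
open Finset

namespace PathCoupling

variable {m K : ℕ}

/-! ## 1. The abstract exchange inequality -/

/-- **EXCHANGE INEQUALITY (abstract form).**  `p` dominant at `θa`, `p'` dominant at `θb > θa`; `q, q'` present with the same slope sum
and the same valuation sum as `p, p'`.  Then `q ≠ p ⇒ slope p < slope q` and `q' ≠ p' ⇒ slope q' < slope p'`, i.e. the dominant pair is the
outer pair.  (Add `tropWeight θa q < tropWeight θa p` and `tropWeight θb q' < tropWeight θb p'`: the valuations cancel and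
`(θb − θa)·(slope q − slope p) > 0`.) [folklore] -/
theorem slope_lt_of_exchange (d : Fin K → ℕ) (v ε : Fin m → Fin m → Fin K → ℤ) {θa θb : ℤ} (hab : θa < θb)
    {p p' q q' : Equiv.Perm (Fin m) × (Fin m → Fin K)} (hp : IsDominant d v ε θa p) (hp' : IsDominant d v ε θb p')
    (hS : slope d q + slope d q' = slope d p + slope d p')
    (hV : ∑ i, v (q.1 i) i (q.2 i) + ∑ i, v (q'.1 i) i (q'.2 i) = ∑ i, v (p.1 i) i (p.2 i) + ∑ i, v (p'.1 i) i (p'.2 i))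
    (hqp : q ≠ p) (hq'p' : q' ≠ p') (hq : termSign ε q ≠ 0) (hq' : termSign ε q' ≠ 0) :
    slope d p < slope d q ∧ slope d q' < slope d p' := by
  have h1 := hp.2 q hqp hq
  have h2 := hp'.2 q' hq'p' hq'
  rw [tropWeight_eq_slope_sub, tropWeight_eq_slope_sub] at h1 h2
  set Sp := slope d p
  set Sp' := slope d p'
  set Sq := slope d q
  set Sq' := slope d q'
  set Vp := ∑ i, v (p.1 i) i (p.2 i)
  set Vp' := ∑ i, v (p'.1 i) i (p'.2 i)
  set Vq := ∑ i, v (q.1 i) i (q.2 i)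
  set Vq' := ∑ i, v (q'.1 i) i (q'.2 i)
  -- h1 : θa * Sq - Vq < θa * Sp - Vp ;  h2 : θb * Sq' - Vq' < θb * Sp' - Vp'
  have hSq' : Sq' = Sp + Sp' - Sq := by linarith
  have hVq' : Vq' = Vp + Vp' - Vq := by linarith
  have k1 : θb * Sp - θb * Sq < Vp - Vq := by
    have e : θb * Sq' = θb * Sp + θb * Sp' - θb * Sq := by rw [hSq']; ring
    linarith
  have k2 : θa * Sq - θa * Sp < Vq - Vp := by linarith
  have hlt : Sp < Sq := by
    by_contra hle
    push Not at hle
    have hnn : 0 ≤ (θb - θa) * (Sp - Sq) := mul_nonneg (by linarith) (by linarith)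
    have e : (θb - θa) * (Sp - Sq) = θb * Sp - θb * Sq + (θa * Sq - θa * Sp) := by ring
    linarith
  exact ⟨hlt, by linarith⟩

/-- the valuation bracket that comes with the exchange inequality: the chord from `p` to `q` has slope strictly between `θa` and `θb`.
[folklore] -/
theorem val_sub_val_btw_of_exchange (d : Fin K → ℕ) (v ε : Fin m → Fin m → Fin K → ℤ) {θa θb : ℤ}
    {p p' q q' : Equiv.Perm (Fin m) × (Fin m → Fin K)} (hp : IsDominant d v ε θa p) (hp' : IsDominant d v ε θb p')
    (hS : slope d q + slope d q' = slope d p + slope d p')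
    (hV : ∑ i, v (q.1 i) i (q.2 i) + ∑ i, v (q'.1 i) i (q'.2 i) = ∑ i, v (p.1 i) i (p.2 i) + ∑ i, v (p'.1 i) i (p'.2 i))
    (hqp : q ≠ p) (hq'p' : q' ≠ p') (hq : termSign ε q ≠ 0) (hq' : termSign ε q' ≠ 0) :
    θa * (slope d q - slope d p) < ∑ i, v (q.1 i) i (q.2 i) - ∑ i, v (p.1 i) i (p.2 i) ∧
      ∑ i, v (q.1 i) i (q.2 i) - ∑ i, v (p.1 i) i (p.2 i) < θb * (slope d q - slope d p) := by
  have h1 := hp.2 q hqp hq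
  have h2 := hp'.2 q' hq'p' hq'
  rw [tropWeight_eq_slope_sub, tropWeight_eq_slope_sub] at h1 h2
  set Sp := slope d p
  set Sp' := slope d p'
  set Sq := slope d q
  set Sq' := slope d q'
  set Vp := ∑ i, v (p.1 i) i (p.2 i)
  set Vp' := ∑ i, v (p'.1 i) i (p'.2 i)
  set Vq := ∑ i, v (q.1 i) i (q.2 i)
  set Vq' := ∑ i, v (q'.1 i) i (q'.2 i)
  have hSq' : Sq' = Sp + Sp' - Sq := by linarith
  have hVq' : Vq' = Vp + Vp' - Vq := by linarith
  have e1 : θa * (Sq - Sp) = θa * Sq - θa * Sp := by ring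
  have e2 : θb * (Sq - Sp) = θb * Sq - θb * Sp := by ring
  have e : θb * Sq' = θb * Sp + θb * Sp' - θb * Sq := by rw [hSq']; ring
  constructor
  · linarith
  · linarith

/-- symmetric form: if in addition `q ≠ p'` and `q' ≠ p`, both new terms lie STRICTLY INSIDE: `slope p < slope q < slope p'`. [folklore] -/
theorem slope_btw_of_exchange (d : Fin K → ℕ) (v ε : Fin m → Fin m → Fin K → ℤ) {θa θb : ℤ} (hab : θa < θb)
    {p p' q q' : Equiv.Perm (Fin m) × (Fin m → Fin K)} (hp : IsDominant d v ε θa p) (hp' : IsDominant d v ε θb p')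
    (hS : slope d q + slope d q' = slope d p + slope d p')
    (hV : ∑ i, v (q.1 i) i (q.2 i) + ∑ i, v (q'.1 i) i (q'.2 i) = ∑ i, v (p.1 i) i (p.2 i) + ∑ i, v (p'.1 i) i (p'.2 i))
    (hqp : q ≠ p) (hqp' : q ≠ p') (hq'p : q' ≠ p) (hq'p' : q' ≠ p') (hq : termSign ε q ≠ 0) (hq' : termSign ε q' ≠ 0) :
    slope d p < slope d q ∧ slope d q < slope d p' := by
  refine ⟨(slope_lt_of_exchange d v ε hab hp hp' hS hV hqp hq'p' hq hq').1, ?_⟩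
  have h := (slope_lt_of_exchange d v ε hab hp hp' (q := q') (q' := q) (by linarith) (by linarith) hq'p hqp' hq' hq).2
  exact h

/-! ## 2. Path-coupled families: co-monotone fibres -/

section Family

variable {ι₁ ι₂ ι₃ : Type*}
variable (d : Fin K → ℕ) (v ε : Fin m → Fin m → Fin K → ℤ)
variable (u : ι₁ → ι₂ → ι₃ → Equiv.Perm (Fin m) × (Fin m → Fin K))
variable (α : ι₁ → ℤ) (β : ι₂ → ℤ) (γ : ι₃ → ℤ) (f : ι₁ → ι₂ → ℤ) (g : ι₂ → ι₃ → ℤ)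

/-- **CO-MONOTONE FIBRES.**  An injective family `u a b c` of present terms with separable slope `α a + β b + γ c` and path-coupled
valuation sum `f a b + g b c`: two members with the same middle index `b` that are dominant at slopes `θa < θb` have both outer coordinates
weakly increasing, strictly where they differ. [folklore] -/
theorem lt_of_fibre (hu : Function.Injective fun t : ι₁ × ι₂ × ι₃ => u t.1 t.2.1 t.2.2)
    (hs : ∀ a b c, slope d (u a b c) = α a + β b + γ c)
    (hV : ∀ a b c, ∑ i, v ((u a b c).1 i) i ((u a b c).2 i) = f a b + g b c)
    (hpres : ∀ a b c, termSign ε (u a b c) ≠ 0)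
    {θa θb : ℤ} (hab : θa < θb) {a a' : ι₁} {b : ι₂} {c c' : ι₃}
    (hk : IsDominant d v ε θa (u a b c)) (hk' : IsDominant d v ε θb (u a' b c')) :
    (c ≠ c' → γ c < γ c') ∧ (a ≠ a' → α a < α a') := by
  have hne : ∀ {a₁ a₂ : ι₁} {b₁ b₂ : ι₂} {c₁ c₂ : ι₃}, u a₁ b₁ c₁ = u a₂ b₂ c₂ → a₁ = a₂ ∧ b₁ = b₂ ∧ c₁ = c₂ := by
    intro a₁ a₂ b₁ b₂ c₁ c₂ h
    have := hu (a₁ := (a₁, b₁, c₁)) (a₂ := (a₂, b₂, c₂)) (by simpa using h)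
    simpa [Prod.mk.injEq] using this
  constructor
  · intro hcc
    -- exchange pair q = u a b c', q' = u a' b c
    have hqp : u a b c' ≠ u a b c := fun h => hcc (hne h).2.2.symm
    have hq'p' : u a' b c ≠ u a' b c' := fun h => hcc (hne h).2.2
    have h := slope_lt_of_exchange d v ε hab hk hk' (q := u a b c') (q' := u a' b c)
      (by rw [hs, hs, hs, hs]; ring) (by rw [hV, hV, hV, hV]; ring) hqp hq'p' (hpres _ _ _) (hpres _ _ _)
    have h1 := h.1
    rw [hs, hs] at h1
    linarith
  · intro haa
    have hqp : u a' b c ≠ u a b c := fun h => haa (hne h).1.symm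
    have hq'p' : u a b c' ≠ u a' b c' := fun h => haa (hne h).1
    have h := slope_lt_of_exchange d v ε hab hk hk' (q := u a' b c) (q' := u a b c')
      (by rw [hs, hs, hs, hs]; ring) (by rw [hV, hV, hV, hV]; ring) hqp hq'p' (hpres _ _ _) (hpres _ _ _)
    have h1 := h.1
    rw [hs, hs] at h1
    linarith

/-- weak form of `lt_of_fibre`: both outer coordinates are weakly increasing inside a fibre. [folklore] -/
theorem le_of_fibre (hu : Function.Injective fun t : ι₁ × ι₂ × ι₃ => u t.1 t.2.1 t.2.2)
    (hs : ∀ a b c, slope d (u a b c) = α a + β b + γ c)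
    (hV : ∀ a b c, ∑ i, v ((u a b c).1 i) i ((u a b c).2 i) = f a b + g b c)
    (hpres : ∀ a b c, termSign ε (u a b c) ≠ 0)
    {θa θb : ℤ} (hab : θa < θb) {a a' : ι₁} {b : ι₂} {c c' : ι₃}
    (hk : IsDominant d v ε θa (u a b c)) (hk' : IsDominant d v ε θb (u a' b c')) :
    γ c ≤ γ c' ∧ α a ≤ α a' := by
  have h := lt_of_fibre d v ε u α β γ f g hu hs hV hpres hab hk hk'
  constructor
  · by_cases hcc : c = c'
    · rw [hcc]
    · exact (h.1 hcc).le
  · by_cases haa : a = a'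
    · rw [haa]
    · exact (h.2 haa).le

/-! ## 3. The count: a fibre meets a dominant chain in at most `|ι₁| + |ι₃| − 1` terms -/

variable [Fintype ι₁] [Fintype ι₂] [Fintype ι₃]

omit [Fintype ι₂] in
/-- **FIBRE COUNT.**  Along a chain `p 0, …, p n` of terms dominant at strictly increasing slopes with consecutive terms distinct, the indices whose term
is `u a b c` with a FIXED middle index `b` number at most `|ι₁| + |ι₃| − 1`: the rank `#{a₀ : α a₀ < α a} + #{c₀ : γ c₀ < γ c}` strictly
increases along them (`lt_of_fibre`). [folklore: a chain in a product of two total orders] -/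
theorem card_fibre_le (hu : Function.Injective fun t : ι₁ × ι₂ × ι₃ => u t.1 t.2.1 t.2.2)
    (hs : ∀ a b c, slope d (u a b c) = α a + β b + γ c)
    (hV : ∀ a b c, ∑ i, v ((u a b c).1 i) i ((u a b c).2 i) = f a b + g b c)
    (hpres : ∀ a b c, termSign ε (u a b c) ≠ 0)
    {n : ℕ} (θ : Fin (n + 1) → ℤ) (p : Fin (n + 1) → Equiv.Perm (Fin m) × (Fin m → Fin K))
    (hθ : StrictMono θ) (hdom : ∀ k, IsDominant d v ε (θ k) (p k)) (hne : ∀ k : Fin n, p k.castSucc ≠ p k.succ) (b : ι₂) :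
    (univ.filter fun k => ∃ a c, p k = u a b c).card ≤ Fintype.card ι₁ + Fintype.card ι₃ - 1 := by
  classical
  have hinj : Function.Injective p := injective_of_chainD d v ε θ p hθ hdom hne
  set F := univ.filter fun k => ∃ a c, p k = u a b c with hF
  rcases F.eq_empty_or_nonempty with hFe | ⟨k₀, hk₀⟩
  · rw [hFe]; simp
  -- total choice functions for the coordinates of the members
  obtain ⟨a₀, c₀, h₀⟩ := (mem_filter.mp hk₀).2
  have hex : ∀ k : Fin (n + 1), ∃ a c, k ∈ F → p k = u a b c := by
    intro k
    by_cases hk : k ∈ F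
    · obtain ⟨a, c, h⟩ := (mem_filter.mp hk).2
      exact ⟨a, c, fun _ => h⟩
    · exact ⟨a₀, c₀, fun h => absurd h hk⟩
  choose A C hAC using hex
  -- the rank function
  let φ : Fin (n + 1) → ℕ := fun k =>
    (univ.filter fun a => α a < α (A k)).card + (univ.filter fun c => γ c < γ (C k)).card
  -- strictly increasing along F
  have hmono : ∀ k ∈ F, ∀ k' ∈ F, k < k' → φ k < φ k' := by
    intro k hk k' hk' hkk'
    have hpk := hAC k hk
    have hpk' := hAC k' hk'
    have hdk : IsDominant d v ε (θ k) (u (A k) b (C k)) := hpk ▸ hdom k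
    have hdk' : IsDominant d v ε (θ k') (u (A k') b (C k')) := hpk' ▸ hdom k'
    have hlt := lt_of_fibre d v ε u α β γ f g hu hs hV hpres (hθ hkk') hdk hdk'
    have hle := le_of_fibre d v ε u α β γ f g hu hs hV hpres (hθ hkk') hdk hdk'
    -- the two coordinates are not both equal (the terms differ)
    have hne : A k ≠ A k' ∨ C k ≠ C k' := by
      by_contra hcon
      push Not at hcon
      apply hinj.ne (ne_of_lt hkk')
      rw [hpk, hpk', hcon.1, hcon.2]
    -- monotone pieces
    have subA : (univ.filter fun a => α a < α (A k)) ⊆ (univ.filter fun a => α a < α (A k')) := by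
      intro a ha
      simp only [mem_filter, mem_univ, true_and] at ha ⊢
      exact lt_of_lt_of_le ha hle.2
    have subC : (univ.filter fun c => γ c < γ (C k)) ⊆ (univ.filter fun c => γ c < γ (C k')) := by
      intro c hc
      simp only [mem_filter, mem_univ, true_and] at hc ⊢
      exact lt_of_lt_of_le hc hle.1
    rcases hne with hA | hC
    · have hssub : (univ.filter fun a => α a < α (A k)) ⊂ (univ.filter fun a => α a < α (A k')) := by
        refine ⟨subA, fun hsub => ?_⟩
        have hmem : A k ∈ (univ.filter fun a => α a < α (A k')) := by
          simp only [mem_filter, mem_univ, true_and]; exact hlt.2 hA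
        have := hsub hmem
        simp only [mem_filter, mem_univ, true_and, lt_self_iff_false] at this
      have := card_lt_card hssub
      have := card_le_card subC
      simp only [φ]
      omega
    · have hssub : (univ.filter fun c => γ c < γ (C k)) ⊂ (univ.filter fun c => γ c < γ (C k')) := by
        refine ⟨subC, fun hsub => ?_⟩
        have hmem : C k ∈ (univ.filter fun c => γ c < γ (C k')) := by
          simp only [mem_filter, mem_univ, true_and]; exact hlt.1 hC
        have := hsub hmem
        simp only [mem_filter, mem_univ, true_and, lt_self_iff_false] at this
      have := card_lt_card hssub
      have := card_le_card subA
      simp only [φ]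
      omega
  -- φ is injective on F and bounded
  have hinjφ : Set.InjOn φ F := by
    intro k hk k' hk' hφ
    rcases lt_trichotomy k k' with h | h | h
    · exact absurd hφ (ne_of_lt (hmono k hk k' hk' h))
    · exact h
    · exact absurd hφ.symm (ne_of_lt (hmono k' hk' k hk h))
  have hbd : ∀ k ∈ F, φ k ∈ range (Fintype.card ι₁ + Fintype.card ι₃ - 1) := by
    intro k _
    rw [mem_range]
    have h1 : (univ.filter fun a => α a < α (A k)).card < Fintype.card ι₁ := by
      rw [← card_univ]
      apply card_lt_card
      refine ⟨filter_subset _ _, fun hsub => ?_⟩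
      have := hsub (mem_univ (A k))
      simp only [mem_filter, mem_univ, true_and, lt_self_iff_false] at this
    have h3 : (univ.filter fun c => γ c < γ (C k)).card < Fintype.card ι₃ := by
      rw [← card_univ]
      apply card_lt_card
      refine ⟨filter_subset _ _, fun hsub => ?_⟩
      have := hsub (mem_univ (C k))
      simp only [mem_filter, mem_univ, true_and, lt_self_iff_false] at this
    simp only [φ]
    omega
  calc F.card ≤ (range (Fintype.card ι₁ + Fintype.card ι₃ - 1)).card := card_le_card_of_injOn φ hbd hinjφ
    _ = Fintype.card ι₁ + Fintype.card ι₃ - 1 := card_range _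

/-- **FAMILY COUNT (path-coupled families are quadratic).**  Along a chain of terms dominant at strictly increasing slopes (consecutive terms
distinct),
at most `|ι₂|·(|ι₁| + |ι₃| − 1)` indices carry a term of a path-coupled family `u a b c` — against the `|ι₁|·|ι₂|·|ι₃|` members of the family.
[folklore] -/
theorem card_family_le (hu : Function.Injective fun t : ι₁ × ι₂ × ι₃ => u t.1 t.2.1 t.2.2)
    (hs : ∀ a b c, slope d (u a b c) = α a + β b + γ c)
    (hV : ∀ a b c, ∑ i, v ((u a b c).1 i) i ((u a b c).2 i) = f a b + g b c)
    (hpres : ∀ a b c, termSign ε (u a b c) ≠ 0)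
    {n : ℕ} (θ : Fin (n + 1) → ℤ) (p : Fin (n + 1) → Equiv.Perm (Fin m) × (Fin m → Fin K))
    (hθ : StrictMono θ) (hdom : ∀ k, IsDominant d v ε (θ k) (p k)) (hne : ∀ k : Fin n, p k.castSucc ≠ p k.succ) :
    (univ.filter fun k => ∃ a b c, p k = u a b c).card ≤ Fintype.card ι₂ * (Fintype.card ι₁ + Fintype.card ι₃ - 1) := by
  classical
  have hcover : (univ.filter fun k => ∃ a b c, p k = u a b c) ⊆
      (univ : Finset ι₂).biUnion fun b => univ.filter fun k => ∃ a c, p k = u a b c := by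
    intro k hk
    obtain ⟨a, b, c, h⟩ := (mem_filter.mp hk).2
    rw [mem_biUnion]
    exact ⟨b, mem_univ _, mem_filter.mpr ⟨mem_univ _, a, c, h⟩⟩
  calc (univ.filter fun k => ∃ a b c, p k = u a b c).card
      ≤ ((univ : Finset ι₂).biUnion fun b => univ.filter fun k => ∃ a c, p k = u a b c).card := card_le_card hcover
    _ ≤ ∑ b, (univ.filter fun k => ∃ a c, p k = u a b c).card := card_biUnion_le
    _ ≤ ∑ _b : ι₂, (Fintype.card ι₁ + Fintype.card ι₃ - 1) :=
        sum_le_sum fun b _ => card_fibre_le d v ε u α β γ f g hu hs hV hpres θ p hθ hdom hne b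
    _ = Fintype.card ι₂ * (Fintype.card ι₁ + Fintype.card ι₃ - 1) := by rw [sum_const, card_univ, smul_eq_mul]

end Family

end PathCoupling

end Summit.ValiantsHypothesis.ValiantsHypothesis.Theorems.KPlusLogSqLaw
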